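import Summits.NavierStokesRegularity.FluidComputer.PalasekTowerEpisodes
import Summits.NavierStokesRegularity.FluidComputer.PalasekTowerLedger

/-!
# The episode split of Palasek's Step 2, RE-PINNED after the K-probe (K1R / K2R), with the assembly

Cell `ns-blowup`, seat `ns-blowup-lean` (g2); companion of `PalasekTowerEpisodes.lean` (p404510) and
`PalasekTowerKelvinLedger.lean`. LABEL: E-C typing (KERNEL). WHAT THIS IS NOT: not Navier–Stokes
evidence, not a construction — two open `Prop`s re-typed so that the refuter's calibration junk
fails them, and the (proved) bookkeeping around them. Nothing is asserted or inhabited here.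

## Why a re-pin (refuter g8 K-PROBE «EpisodeRealisation», HOME/refuter/KPROBE-EPISODES.md; referee CONCUR)

The split `EpisodeBase` (K1) / `EpisodeInduction` (K2) of p404510, read literally, is killed twice:
(K-A) K1 is inhabited by a PRESCRIBED VELOCITY `u = a(t)·V(x/L)` (rigidly rotating cut-off core, slowly
spun up inside the visibility window, dilated by `L → ∞` so that `(V·∇)V/L` and `νΔV/L²` leave the
residual force), because `gap` is strict only, `c₄ = c₁` is admissible and `radius` is free; (K-B) K2
quantifies over EVERY schedule and stage, so the same junk `S₀` (level 1 inhabited, level 2 empty by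
forced uniqueness `hU` + the floor `c₁Y₂ > c₁Y₁`) gives `hU → ¬ K2`. Repairs asked: (R-a) a
QUANTITATIVE pin "the admissible force cannot supply the jump"; (R-b) SCALE pins (strain floor);
(R-c) Kelvin-ledger pins (margin register — not typed here, note at `Margins.withStrain`); (R-d) K2
must not be refutable by foreign junk schedules.

## What this file types (NO new structure, NO edit of a landed file)

* §1 `Schedule.Pins S Λ θ` (R-a, R-d): the IMPULSE pin
  `Λ · c₄ · Y_k · (τ_{k+1} - τ_k) ≤ c₁ Y_{k+1} - c₂ Y_k` for every `k` — over the WHOLE growth interval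
  (not only the visibility window) an admissible force (`push_small : ‖f‖ ≤ c₄ Y_k`) can change any
  fluid particle's velocity by at most `1/Λ` of the jump of the maximal speed that the floors and
  ceilings demand — and the SEPARATION pin `θ · c₂ · Y_k ≤ c₁ · Y_{k+1}` (each level multiplies the
  previous ceiling by at least the registered factor `θ`). `Λ`, `θ` are numbers the route registers
  (the refuter asked `Λ ≥ 3`; `θ > 1`), plus CONFINEMENT of datum and force to the ball `B̄(0, radius)`
  (no far-field passengers in a schedule). With `c₂ ≥ c₁` (forced by any stage, `Stage.c₁_le_c₂`) the
  separation pin costs `N_k^{(b-1)(β-1)} ≥ θ` at EVERY level (`TowerRates.Y_succ`), in particular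
  `N₀^{(b-1)(β-1)} ≥ θ`: at `b = 11/10`, `β = 23/10` this is `N₀ ≥ θ^{100/13}` (`N₀ ≥ 207` for
  `θ = 2`); `TowerRates.canonical` (`N₀ = 2`, `Y₁/Y₀ = 2^{0.13} ≈ 1.094`) carries NO `θ ≥ 1.1` — the
  K-probe's table §C ("super-lacunarity has not started") in one line. A wide-base record
  `TowerRates.wide` (`N₀ = 256`) is supplied with `2 · Y_k ≤ Y_{k+1}` proved (`TowerRates.wide_sep`).
* §2 `Margins.withStrain m` (R-b): the margin transformer adding the STRAIN FLOOR
  `∃ x ∈ B̄(0, radius), c₁ · A_j ≤ ‖∇u(τ_j)(x)‖` for every grown level `j ≤ k` (same constant `c₁`: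
  a velocity `c₁ Y_j = c₁ A_j / N_j` living at scale `1/N_j`). A dilated blob `a(t)V(x/L)` with
  `a(τ_j)·max|V| ≤ c₂ Y_j` then needs `L ≤ c₂ ‖∇V‖_∞ / (c₁ max|V| · N_j)`: the dilation lever of
  (K-A) is gone, and `push_small` sees `ν a ‖ΔV‖/L²` and `a²(V·∇)V/L` undiluted.
* §3 K1R `EpisodeBasePinned ν R Λ θ m := ∃ S, S.Pins Λ θ ∧ Nonempty (Stage ν R S (withStrain m) 1)`
  and K2R `EpisodeInductionPinned ν R Λ θ m := ∀ S, S.Pins Λ θ → ∀ k ≥ 1, ∀ s : Stage … k, ∃ s'`.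
  (R-d): K2R is VACUOUS on every un-pinned schedule, and on a pinned one it can only be attacked
  through a genuine pinned, strained stage — the calibration object `S₀` must now FAIL `Stage … 1`
  (refuter re-probe; the typist's arithmetic is in the two bullets above). What K2R still says
  beyond "heredity of the object K1R produces" is said openly: heredity ROBUST against every
  admissible force, i.e. one of impulse `≤ (jump)/Λ` per interval — `Λ` is the filer's dial.
* §4 THE ASSEMBLY `nonempty_realisation_of_episodesPinned : K1R → K2R → Nonempty (Realisation ν R)`,
  PROVED from the landed `Realisation.ofEpisodes`, and `palasekStep2_of_episodesPinned` (all
  viscosities; the one-viscosity form lives in the Theorems-side assembly module, via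
  `palasekStep2_of_realisation`); with the landed bridge
  `navierStokesBreakdownR3_of_step2` this reaches Fefferman's (C) modulo W21′ exactly as before.
* §5 DIRECTIONS OF THE REPAIR, kernel-visible: `EpisodeBasePinned → EpisodeBase (withStrain m)` (K1
  strengthened), `EpisodeInduction (withStrain m) → EpisodeInductionPinned` (K2 weakened); monotonicity.

References: S. Palasek, arXiv:2605.13827 §3.3, §4 [cite: Palasek2026ElementaryModel, §3–§4];
C. L. Fefferman, Clay problem description, (C) [cite: FeffermanClay2006, (C)].
-/

noncomputable section

namespace Summit.NavierStokesRegularity.FluidComputer.PalasekTowerClayBridge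

open Set MeasureTheory Filter Topology Function
open scoped ENNReal ContDiff NNReal
open Literature.Analysis.FluidPDE

/-! ## §0 Rate arithmetic: the separation available at level `k` -/

namespace TowerRates

variable (R : TowerRates)

/-- The velocity scales obey `Y_{k+1} = N_k^{(b-1)(β-1)} · Y_k` (from `N_{k+1} = N_k^b`).
[cite: Palasek2026ElementaryModel, §1.2] -/
theorem Y_succ (k : ℕ) : R.Y (k + 1) = R.N k ^ ((R.b - 1) * (R.β - 1)) * R.Y k := by
  simp only [TowerRates.Y]
  rw [R.N_succ k, ← Real.rpow_mul (R.N_pos k).le, ← Real.rpow_add (R.N_pos k)]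
  congr 1
  ring

/-- The scales dominate the base scale: `N₀ ≤ N_k`. [cite: Palasek2026ElementaryModel, §1.2] -/
theorem N₀_le_N (k : ℕ) : R.N₀ ≤ R.N k := by
  simp only [TowerRates.N]
  conv_lhs => rw [← Real.rpow_one R.N₀]
  exact Real.rpow_le_rpow_of_exponent_le R.one_lt_N₀.le (one_le_pow₀ R.one_lt_b.le)

/-- The separation exponent `(b-1)(β-1)` is positive. [folklore] -/
theorem sepExp_pos : 0 < (R.b - 1) * (R.β - 1) := by
  have hb := R.one_lt_b
  have hβ := R.two_lt_β
  exact mul_pos (by linarith) (by linarith)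

/-- **Separation available at every level is at least the base separation**:
`N₀^{(b-1)(β-1)} · Y_k ≤ Y_{k+1}`. So a separation pin `θ c₂ Y_k ≤ c₁ Y_{k+1}` with `c₂ ≥ c₁ > 0`
is satisfiable at all levels as soon as `θ ≤ N₀^{(b-1)(β-1)}`, and at no level if
`θ > N_k^{(b-1)(β-1)}` for some `k` (the binding level is `k = 0`). [folklore] -/
theorem base_sep_mul_Y_le_Y_succ (k : ℕ) :
    R.N₀ ^ ((R.b - 1) * (R.β - 1)) * R.Y k ≤ R.Y (k + 1) := by
  rw [R.Y_succ k]
  have hY : 0 < R.Y k := Real.rpow_pos_of_pos (R.N_pos k) _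
  refine mul_le_mul_of_nonneg_right ?_ hY.le
  exact Real.rpow_le_rpow (le_trans zero_le_one R.one_lt_N₀.le) (R.N₀_le_N k) R.sepExp_pos.le

/-- **A wide-base rates record** (`N₀ = 256`, `b = 11/10`, `β = 23/10`, `α = 49/20`): the same
exponents as `TowerRates.canonical` (DC1/DC4 hold verbatim) with a base scale large enough that
consecutive velocity scales are separated by a factor `≥ 2` from level `0` on
(`256^{0.13} = 2^{1.04}`). [folklore] -/
def wide : TowerRates where
  N₀ := 256
  b := 11 / 10
  β := 23 / 10
  α := 49 / 20
  one_lt_N₀ := by norm_num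
  one_lt_b := by norm_num
  two_b_lt_β := by norm_num
  β_lt_α := by norm_num
  two_lt_α := by norm_num
  α_le := by norm_num
  β_lt_one_add_sqrt_two := by
    have h : (7 : ℝ) / 5 < Real.sqrt 2 := by
      rw [Real.lt_sqrt (by norm_num)]
      norm_num
    linarith

/-- For the wide-base record every level at least DOUBLES the velocity scale: `2 Y_k ≤ Y_{k+1}`
(`N₀^{(b-1)(β-1)} = 256^{13/100} = 2^{104/100} ≥ 2`). [folklore] -/
theorem wide_sep (k : ℕ) : 2 * wide.Y k ≤ wide.Y (k + 1) := by
  refine le_trans ?_ (wide.base_sep_mul_Y_le_Y_succ k)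
  have hY : 0 < wide.Y k := Real.rpow_pos_of_pos (wide.N_pos k) _
  refine mul_le_mul_of_nonneg_right ?_ hY.le
  have hexp : (wide.b - 1) * (wide.β - 1) = 13 / 100 := by
    simp only [wide]; norm_num
  have hN : wide.N₀ = (2 : ℝ) ^ (8 : ℝ) := by
    simp only [wide]; norm_num
  rw [hexp, hN, ← Real.rpow_mul (by norm_num : (0 : ℝ) ≤ 2)]
  conv_lhs => rw [← Real.rpow_one 2]
  exact Real.rpow_le_rpow_of_exponent_le (by norm_num) (by norm_num)

end TowerRates

/-! ## §1 The schedule pins (R-a, R-d) -/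

/-- **Registered pins on a schedule** (repairs R-a / R-d of the K-probe). `impulse`: over the whole
growth interval `[τ_k, τ_{k+1}]` the admissible force (`‖f‖ ≤ c₄ Y_k` there, `Schedule.push_small`)
has impulse `c₄ Y_k (τ_{k+1} - τ_k)` at most `1/Λ` of the jump `c₁ Y_{k+1} - c₂ Y_k` which the
maximal speed in the ball must make between the invisibility phase (`Stage.quiet`/`Stage.ceiling`:
`≤ c₂ Y_k`) and the readout (`Stage.floor`: `≥ c₁ Y_{k+1}`) — so a velocity field whose material
acceleration is force-dominated (every prescribed-velocity fake after the dilation lever is removed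
by the strain floor) cannot make the jump. `sep`: the jump itself is quantitative, each level
multiplying the previous ceiling by at least `θ`. `datum_confined` / `force_confined`: datum and force
vanish outside the ball `B̄(0, radius)` (R-d: the induction K2R quantifies over all pinned schedules,
so a schedule must not be able to carry far-field passengers timed to break a later ceiling; a
designed tower loses nothing — enlarge `radius`). The route registers the numbers `Λ` (refuter:
`≥ 3`) and `θ` (`> 1`); see `TowerRates.base_sep_mul_Y_le_Y_succ` for what `θ` costs in `N₀`.
[cite: Palasek2026ElementaryModel, §3.3] -/
structure Schedule.Pins {R : TowerRates} (S : Schedule R) (Λ θ : ℝ) : Prop where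
  /-- R-a, interval form: force impulse per growth interval ≤ (velocity jump)/Λ -/
  impulse : ∀ k, Λ * (S.c₄ * R.Y k) * (S.τ (k + 1) - S.τ k) ≤ S.c₁ * R.Y (k + 1) - S.c₂ * R.Y k
  /-- quantitative separation of consecutive levels: `θ c₂ Y_k ≤ c₁ Y_{k+1}` -/
  sep : ∀ k, θ * (S.c₂ * R.Y k) ≤ S.c₁ * R.Y (k + 1)
  /-- the datum is CONFINED to the tower's ball (no far-field passengers) -/
  datum_confined : ∀ x, S.radius < ‖x‖ → S.u₀ x = 0
  /-- the force is CONFINED to the tower's ball at all times -/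
  force_confined : ∀ t x, S.radius < ‖x‖ → S.f t x = 0

namespace Schedule

variable {R : TowerRates} (S : Schedule R)

/-- The window force constant of a schedule is nonnegative (`0 ≤ ‖f‖ ≤ c₄ Y₀` at `t = τ 0`). [folklore] -/
theorem c₄_nonneg : 0 ≤ S.c₄ := by
  have h := S.push_small 0 (S.τ 0) ⟨le_rfl, (S.τ_lt_succ 0).le⟩ 0
  have hY : 0 < R.Y 0 := Real.rpow_pos_of_pos (R.N_pos 0) _
  nlinarith [norm_nonneg (S.f (S.τ 0) 0)]

/-- The force impulse available on a growth interval is nonnegative. [folklore] -/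
theorem impulse_nonneg (k : ℕ) : 0 ≤ S.c₄ * R.Y k * (S.τ (k + 1) - S.τ k) := by
  have hY : 0 < R.Y k := Real.rpow_pos_of_pos (R.N_pos k) _
  have hτ : 0 ≤ S.τ (k + 1) - S.τ k := by linarith [S.τ_lt_succ k]
  exact mul_nonneg (mul_nonneg S.c₄_nonneg hY.le) hτ

namespace Pins

variable {S} {Λ θ Λ' θ' : ℝ}

/-- Under the pins (with `Λ ≥ 0`) every level's floor beats the previous ceiling:
`c₂ Y_k ≤ c₁ Y_{k+1}` — the finite-depth `gap` of `Schedule` at every level. [folklore] -/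
theorem ceiling_le_floor (h : S.Pins Λ θ) (hΛ : 0 ≤ Λ) (k : ℕ) :
    S.c₂ * R.Y k ≤ S.c₁ * R.Y (k + 1) := by
  have h1 := h.impulse k
  have h2 : 0 ≤ Λ * (S.c₄ * R.Y k) * (S.τ (k + 1) - S.τ k) := by
    have h0 := S.impulse_nonneg k
    have e : Λ * (S.c₄ * R.Y k) * (S.τ (k + 1) - S.τ k) =
        Λ * (S.c₄ * R.Y k * (S.τ (k + 1) - S.τ k)) := by ring
    rw [e]
    exact mul_nonneg hΛ h0
  linarith

/-- With a separation factor `θ > 1` and `c₂ ≥ 0` the level jump is a definite fraction of the new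
floor: `c₁ Y_{k+1} - c₂ Y_k ≥ (1 - θ⁻¹) c₁ Y_{k+1}`. [folklore] -/
theorem jump_ge (h : S.Pins Λ θ) (hθ : 1 < θ) (k : ℕ) :
    (1 - θ⁻¹) * (S.c₁ * R.Y (k + 1)) ≤ S.c₁ * R.Y (k + 1) - S.c₂ * R.Y k := by
  have hs := h.sep k
  have hθ0 : 0 < θ := lt_trans zero_lt_one hθ
  have : S.c₂ * R.Y k ≤ θ⁻¹ * (S.c₁ * R.Y (k + 1)) := by
    rw [le_inv_mul_iff₀' hθ0]
    linarith
  nlinarith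

/-- Monotonicity: weaker registered numbers are implied (`Λ' ≤ Λ`, `θ' ≤ θ`; `c₂ ≥ 0`, as any stage
forces). [folklore] -/
theorem mono (h : S.Pins Λ θ) (hΛ : Λ' ≤ Λ) (hθ : θ' ≤ θ) (hc₂ : 0 ≤ S.c₂) : S.Pins Λ' θ' := by
  refine ⟨fun k => ?_, fun k => ?_, h.datum_confined, h.force_confined⟩
  · have h1 := h.impulse k
    have h0 := S.impulse_nonneg k
    have : Λ' * (S.c₄ * R.Y k) * (S.τ (k + 1) - S.τ k) ≤ Λ * (S.c₄ * R.Y k) * (S.τ (k + 1) - S.τ k) := by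
      have := mul_le_mul_of_nonneg_right hΛ h0
      simpa [mul_assoc] using this
    exact this.trans h1
  · have h1 := h.sep k
    have hY : 0 < R.Y k := Real.rpow_pos_of_pos (R.N_pos k) _
    have : θ' * (S.c₂ * R.Y k) ≤ θ * (S.c₂ * R.Y k) :=
      mul_le_mul_of_nonneg_right hθ (mul_nonneg hc₂ hY.le)
    exact this.trans h1

end Pins

end Schedule

/-! ## §2 The strain floor as a margin transformer (R-b) -/

/-- **The strain floor added to a margin** (repair R-b): at stage `k`, every grown level `j ≤ k`
shows a velocity GRADIENT `≥ c₁ A_j = c₁ N_j Y_j` somewhere in the ball at its readout — the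
velocity `≍ Y_j` lives at scale `≲ 1/N_j` (Palasek's `A_k = N_k^β` is the vorticity / strain scale of
level `k`). Same constant `c₁` as the velocity floor (floors are monotone in their constant, so one
constant for both loses nothing). Note for the margin register (R-c, NOT typed here): a dormant
label loop `j > k` carrying circulation `Φ_j ≍ N_j^{β-2}` under the stage-`k` ceiling `|u| ≤ c₂ Y_k`
must have material length `≥ Φ_j / (c₂ Y_k)`, so circulation pins from below are compatible with the
ceiling only for host-scale (long) loops — an upper length pin `≤ C/N_j` would make the margin
vacuous. [cite: Palasek2026ElementaryModel, §3.1] -/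
def Margins.withStrain {R : TowerRates} (m : Margins R) : Margins R := fun S k u =>
  (∀ j, j ≤ k → ∃ x, ‖x‖ ≤ S.radius ∧ S.c₁ * R.A j ≤ ‖fderiv ℝ (u (S.τ j)) x‖) ∧ m S k u

namespace Stage

variable {ν : ℝ} {R : TowerRates} {S : Schedule R} {m : Margins R} {k : ℕ}

/-- Any stage forces `c₁ ≤ c₂` (floor and ceiling of level `0` at `t = τ 0`). [folklore] -/
theorem c₁_le_c₂ (s : Stage ν R S m k) : S.c₁ ≤ S.c₂ := by
  obtain ⟨x, _, hfl⟩ := s.floor 0 (Nat.zero_le k)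
  have hce := s.ceiling 0 (Nat.zero_le k) (S.τ 0) ⟨(S.τ_pos 0).le, le_rfl⟩ x
  have hY : 0 < R.Y 0 := Real.rpow_pos_of_pos (R.N_pos 0) _
  exact le_of_mul_le_mul_right (hfl.trans hce) hY

/-- Any stage forces `0 < c₂`. [folklore] -/
theorem c₂_pos (s : Stage ν R S m k) : 0 < S.c₂ := lt_of_lt_of_le S.c₁_pos s.c₁_le_c₂

/-- The strain floors of a strained stage. [folklore] -/
theorem strain (s : Stage ν R S (Margins.withStrain m) k) :
    ∀ j, j ≤ k → ∃ x, ‖x‖ ≤ S.radius ∧ S.c₁ * R.A j ≤ ‖fderiv ℝ (s.u (S.τ j)) x‖ :=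
  s.margin.1

/-- The registered margin of a strained stage. [folklore] -/
theorem margin_of_withStrain (s : Stage ν R S (Margins.withStrain m) k) : m S k s.u :=
  s.margin.2

/-- Forgetting the strain floor: a strained stage is a stage for the bare margin. [folklore] -/
def forgetStrain (s : Stage ν R S (Margins.withStrain m) k) : Stage ν R S m k where
  u := s.u
  p := s.p
  classical := s.classical
  initial := s.initial
  energy := s.energy
  floor := s.floor
  ceiling := s.ceiling
  quiet := s.quiet
  margin := s.margin.2

end Stage

/-! ## §3 The re-pinned open pieces (K1R, K2R) — never asserted here -/

/-- **K1R — EPISODE BASE, RE-PINNED (open; never asserted here).** Some schedule for the rates `R`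
satisfying the registered pins `(Λ, θ)` admits a STRAINED stage at level `1`: the host (level `0`)
and the first grown level, reached by a jump of the maximal speed by the factor `≥ θ · c₂/c₁ ≥ θ`
that the admissible force can supply at most to the fraction `1/Λ`, at a strain `≥ c₁ A₁` — one
episode of genuine forced-Navier–Stokes dynamics with the registered margin `m`. Finite depth;
Kelvin-compatible (`Literature.Barriers.NavierStokesRegularity.PalasekTowerKelvinCeiling`).
[cite: Palasek2026ElementaryModel, §4] -/
@[conjecture] def EpisodeBasePinned (ν : ℝ) (R : TowerRates) (Λ θ : ℝ) (m : Margins R) : Prop :=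
  ∃ S : Schedule R, S.Pins Λ θ ∧ Nonempty (Stage ν R S (Margins.withStrain m) 1)

/-- **K2R — EPISODE INDUCTION, RE-PINNED (open; the hard piece; never asserted here).** For every
schedule SATISFYING THE REGISTERED PINS and every level `k ≥ 1`, a strained stage at level `k` with
margin `m` extends to one at level `k+1`. Vacuous on un-pinned schedules; on pinned ones the
hypothesis is a genuine strained stage (no prescribed-velocity inhabitant once the dilation lever is
removed and the force impulse is `≤ jump/Λ` — refuter re-probe on the calibration object `S₀`).
Residual `∀ S`-content, said openly: the heredity is asserted ROBUSTLY — for every pinned schedule,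
i.e. against every admissible force (impulse `≤ jump/Λ` per interval, `‖f‖ ≤ c₄ Y_k` pointwise,
Clay class, confined to the ball, silent from `T`) and every confined Clay datum whose evolution
meets the stage-`k` clauses; this is STRONGER than "the designed tower continues", by exactly the
robustness a proof by induction on levels would have to supply anyway. This is where X3″ / heredity /
the Kelvin evasion live. [cite: Palasek2026ElementaryModel, §4] -/
@[conjecture] def EpisodeInductionPinned (ν : ℝ) (R : TowerRates) (Λ θ : ℝ) (m : Margins R) : Prop :=
  ∀ S : Schedule R, S.Pins Λ θ → ∀ k : ℕ, 1 ≤ k → ∀ s : Stage ν R S (Margins.withStrain m) k,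
    ∃ s' : Stage ν R S (Margins.withStrain m) (k + 1), s.Extends s'

/-! ## §4 The assembly (proved) -/

/-- **K1R ∧ K2R ⇒ the interface is inhabited** (same viscosity, any registered numbers and margin):
the pinned schedule of K1R is fed to K2R and the landed gluing `Realisation.ofEpisodes` applies
verbatim. [cite: Palasek2026ElementaryModel, §4] -/
theorem nonempty_realisation_of_episodesPinned {ν : ℝ} {R : TowerRates} {Λ θ : ℝ} {m : Margins R}
    (h₁ : EpisodeBasePinned ν R Λ θ m) (h₂ : EpisodeInductionPinned ν R Λ θ m) :
    Nonempty (Realisation ν R) := by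
  obtain ⟨S, hS, ⟨s₁⟩⟩ := h₁
  exact ⟨Realisation.ofEpisodes S s₁ (fun n s => h₂ S hS (n + 1) (by omega) s)⟩

/-- **K1R ∧ K2R at every viscosity ⇒ `PalasekStep2 R`.** (The one-viscosity form follows with the
covariance `palasekStep2_of_realisation` of `PalasekTowerViscosity.lean`; it is stated in the
Theorems-side assembly module so that this file's import closure stays at `PalasekTowerEpisodes`.)
[cite: Palasek2026ElementaryModel, §4] -/
theorem palasekStep2_of_episodesPinned {R : TowerRates} {Λ θ : ℝ} {m : Margins R}
    (h : ∀ ν : ℝ, 0 < ν → EpisodeBasePinned ν R Λ θ m ∧ EpisodeInductionPinned ν R Λ θ m) :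
    PalasekStep2 R :=
  fun ν hν => nonempty_realisation_of_episodesPinned (h ν hν).1 (h ν hν).2

/-- **The E-C endpoint from the re-pinned split**: K1R and K2R at every viscosity, plus Tao's
unconditional uniqueness with its force slot (W21′, hypothesis `hU`), give Fefferman's (C), by the
landed bridge `navierStokesBreakdownR3_of_step2`. Conditional on all three; none is asserted.
[cite: FeffermanClay2006, (C)] [cite: Palasek2026ElementaryModel, §4] -/
theorem navierStokesBreakdownR3_of_episodesPinned {R : TowerRates} {Λ θ : ℝ} {m : Margins R}
    (h : ∀ ν : ℝ, 0 < ν → EpisodeBasePinned ν R Λ θ m ∧ EpisodeInductionPinned ν R Λ θ m)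
    (hU : tao_unconditional_uniqueness_velocity_forced) :
    Summit.NavierStokesRegularity.NavierStokesRegularity.NavierStokesBreakdownR3 :=
  navierStokesBreakdownR3_of_step2 R hU (palasekStep2_of_episodesPinned h)

/-! ## §5 Directions of the repair and monotonicity (kernel-visible bookkeeping) -/

/-- K1 was STRENGTHENED: the re-pinned base implies the old base at the strained margin. [folklore] -/
theorem EpisodeBasePinned.episodeBase {ν : ℝ} {R : TowerRates} {Λ θ : ℝ} {m : Margins R}
    (h : EpisodeBasePinned ν R Λ θ m) : EpisodeBase ν R (Margins.withStrain m) := by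
  obtain ⟨S, _, hs⟩ := h
  exact ⟨S, hs⟩

/-- … and further the old base at the bare margin. [folklore] -/
theorem EpisodeBasePinned.episodeBase_forget {ν : ℝ} {R : TowerRates} {Λ θ : ℝ} {m : Margins R}
    (h : EpisodeBasePinned ν R Λ θ m) : EpisodeBase ν R m := by
  obtain ⟨S, _, ⟨s⟩⟩ := h
  exact ⟨S, ⟨s.forgetStrain⟩⟩

/-- K2 was WEAKENED: the old induction at the strained margin implies the re-pinned one. [folklore] -/
theorem EpisodeInductionPinned.of_episodeInduction {ν : ℝ} {R : TowerRates} {Λ θ : ℝ}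
    {m : Margins R} (h : EpisodeInduction ν R (Margins.withStrain m)) :
    EpisodeInductionPinned ν R Λ θ m :=
  fun S _ k hk s => h S k hk s

/-- Monotonicity of K1R in the registered numbers: larger `(Λ, θ)` is the stronger claim. [folklore] -/
theorem EpisodeBasePinned.mono {ν : ℝ} {R : TowerRates} {Λ θ Λ' θ' : ℝ} {m : Margins R}
    (h : EpisodeBasePinned ν R Λ θ m) (hΛ : Λ' ≤ Λ) (hθ : θ' ≤ θ) : EpisodeBasePinned ν R Λ' θ' m := by
  obtain ⟨S, hS, ⟨s⟩⟩ := h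
  exact ⟨S, hS.mono hΛ hθ s.c₂_pos.le, ⟨s⟩⟩

/-- Antitonicity of K2R in the registered numbers: larger `(Λ, θ)` is the weaker claim. [folklore] -/
theorem EpisodeInductionPinned.anti {ν : ℝ} {R : TowerRates} {Λ θ Λ' θ' : ℝ} {m : Margins R}
    (h : EpisodeInductionPinned ν R Λ' θ' m) (hΛ : Λ' ≤ Λ) (hθ : θ' ≤ θ) :
    EpisodeInductionPinned ν R Λ θ m :=
  fun S hS k hk s => h S (hS.mono hΛ hθ s.c₂_pos.le) k hk s

/-! ## §6 What a pinned, strained stage hands the refuter (calibration arithmetic, kernel part) -/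

namespace Stage

variable {ν : ℝ} {R : TowerRates} {S : Schedule R} {m : Margins R} {k : ℕ} {Λ θ : ℝ}

/-- **The jump a stage at level `k+1` makes inside the last growth interval.** At some point of the
ball the speed at `τ (k+1)` is `≥ c₁ Y_{k+1}`, while at every point the speed at `τ k` was
`≤ c₂ Y_k`; under the pins the difference is `≥ Λ ×` the force impulse of the interval and
`≥ (1 - θ⁻¹) c₁ Y_{k+1}`. (The typed half of the calibration test; the refuter's half is that a
prescribed velocity with force-dominated acceleration changes speed by at most the impulse.)
[cite: Palasek2026ElementaryModel, §3.3] -/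
theorem jump (s : Stage ν R S m (k + 1)) (hP : S.Pins Λ θ) :
    ∃ x, ‖x‖ ≤ S.radius ∧
      (∀ y, ‖s.u (S.τ k) y‖ ≤ S.c₂ * R.Y k) ∧ S.c₁ * R.Y (k + 1) ≤ ‖s.u (S.τ (k + 1)) x‖ ∧
      Λ * (S.c₄ * R.Y k) * (S.τ (k + 1) - S.τ k) ≤ S.c₁ * R.Y (k + 1) - S.c₂ * R.Y k := by
  obtain ⟨x, hx, hfl⟩ := s.floor (k + 1) le_rfl
  refine ⟨x, hx, fun y => ?_, hfl, hP.impulse k⟩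
  exact s.ceiling k (Nat.le_succ k) (S.τ k) ⟨(S.τ_pos k).le, le_rfl⟩ y

end Stage

end Summit.NavierStokesRegularity.FluidComputer.PalasekTowerClayBridge

end
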